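import Summits.QuantumFields.YangMills.Theorems.ColdStartUniversalityLatticeLangevinSkeletonFrequencies
import Summits.QuantumFields.YangMills.Theorems.ColdStartUniversalityLatticeLangevinAlmostSureRate
import HarnessLib

/-!
# Route `ColdStartUniversality` (fixed-cut-off SZZ dynamics, sampler statistics): ★★★ VOLUME-FREE ALMOST-SURE CONVERGENCE RATE
# `4√(coth(λh/2)·log N/N)` FOR DISCRETE SAMPLES OF ALL BOUNDED OBSERVABLES after the `O(log L)` burn-in, `|β'| < 1/12`

Helper file (seat `ym-line-csu-p1`, g37; `--supports stmt-QuantumFields-24809`).  SU(2) lattice Langevin dynamics of Shen–Zhu–Zhu at `(L, β')`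
with `|β'| < 1/12` (`λ = 1 − 12|β'|`), Wilson measure `μ = μ_{β'}`, samples `U_{a+kh}` at any spacing `h > 0` after the burn-in
`a = 2 + t₀ + u`, `log B ≤ 2λt₀`, `r = e^{−λh}`.  g34's almost-sure rate (`ae_eventually_abs_average_sub_wilson_lt`) is
`8·max(1, C/(1−e^{−ch}))·√(log N/N)` with the HARRIS constants `C, c` of the volume; the sharp volume-free Hoeffding inequality of
`…SkeletonFrequencies` (León–Perron variance proxy) and the first Borel–Cantelli lemma give:

* ★ `ae_eventually_abs_lt_sqrt_log_div_of_le_mul_exp` — generic: tails `P[|X_n| ≥ ε] ≤ K·exp(−(n+1)ε²/a)` ⇒ almost surely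
  `|X_n| < √(2a·log(n+1)/(n+1))` eventually (`Σ K/(n+1)² < ∞`; g34's lemma is the case `K = 2`);
* ★★★ `ae_eventually_abs_average_sub_wilson_lt_uniform` — for EVERY strong solution from a deterministic start, EVERY bounded measurable `G`
  with `|G| ≤ 1` and every `h > 0`: almost surely, for all sufficiently large `N`,
  `|N⁻¹ Σ_{k<N} G(U_{2+t₀+u+kh}) − ∫ G dμ_{β'}| < 4·√(((1+r)/(1−r))·log N/N)` — NO dependence on `L`;
* ★★★ `ae_eventually_abs_frequency_sub_wilson_lt_uniform` — empirical frequencies of ANY event `A`: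
  `|N⁻¹ #{k<N : U_{2+t₀+u+kh} ∈ A} − μ_{β'}(A)| < 2·√(((1+r)/(1−r))·log N/N)` eventually, almost surely.

[cite: LeonPerron2004, Theorem 1] [cite: DiaconisSaloffcoste1996, Theorem 3.7].  THEOREMS ONLY, no definition, no sorry.  HONEST FRAMING:
RECORD-rung R3 plumbing at FIXED cut-off in LATTICE units, high-temperature window `|β'| < 1/12`; the route's scaling `β'_K → ∞` leaves the
window; `UniformColdStartMixing` (24809) is NOT restated; nothing K-uniform is proved; no crux, rung or summit statement is proved; the
Yang–Mills mass gap is NOT proved.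
-/

set_option autoImplicit false

noncomputable section

namespace Summit.QuantumFields.YangMills.Theorems.ColdStartUniversality

open MeasureTheory ProbabilityTheory Filter Topology Set
open scoped NNReal ENNReal BigOperators
open Literature.Probability.Process Literature.MathematicalPhysics.QuantumFieldTheory
open Literature.MathematicalPhysics.QuantumLattice (fundamentalRep fundamentalLatticeRep continuous_fundamentalRep)

/-! ## §1. Generic: sub-Gaussian tails with any prefactor give the almost-sure rate -/

/-- ★ **Borel–Cantelli rate from sub-Gaussian tails with a prefactor.**  If `P[|X_n| ≥ ε] ≤ K·exp(−(n+1)ε²/a)` for all `n` and all `ε > 0`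
(`a > 0`, `K ≥ 0`), then almost surely `|X_n| < √(2a·log(n+1)/(n+1))` for all sufficiently large `n` (`P(s_n) ≤ K/(n+1)²` is summable).
[folklore] -/
theorem ae_eventually_abs_lt_sqrt_log_div_of_le_mul_exp {Ω : Type*} [MeasurableSpace Ω] {P : Measure Ω} [IsProbabilityMeasure P]
    (X : ℕ → Ω → ℝ) {a K : ℝ} (ha : 0 < a) (hK : 0 ≤ K)
    (hX : ∀ (n : ℕ) (ε : ℝ), 0 < ε → P.real {ω | ε ≤ |X n ω|} ≤ K * Real.exp (-((n + 1) * ε ^ 2) / a)) :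
    ∀ᵐ ω ∂P, ∀ᶠ n : ℕ in atTop, |X n ω| < Real.sqrt (2 * a * Real.log (n + 1) / (n + 1)) := by
  set s : ℕ → Set Ω := fun n => {ω | Real.sqrt (2 * a * Real.log (n + 1) / (n + 1)) ≤ |X n ω|} with hs
  -- `P(s_n) ≤ (K + 1)/(n+1)²`
  have hbound : ∀ n : ℕ, P.real (s n) ≤ (K + 1) / ((n : ℝ) + 1) ^ 2 := by
    intro n
    have hn1 : (0 : ℝ) < (n : ℝ) + 1 := by positivity
    rcases Nat.eq_zero_or_pos n with hn | hn
    · subst hn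
      calc P.real (s 0) ≤ 1 := measureReal_le_one
        _ ≤ (K + 1) / ((0 : ℕ) + 1 : ℝ) ^ 2 := by norm_num; linarith
    have hn' : (1 : ℝ) ≤ n := by exact_mod_cast hn
    have hlog : 0 < Real.log ((n : ℝ) + 1) := Real.log_pos (by linarith)
    have hε : 0 < Real.sqrt (2 * a * Real.log (n + 1) / (n + 1)) := Real.sqrt_pos.2 (by positivity)
    have h1 := hX n _ hε
    have hsq : Real.sqrt (2 * a * Real.log (n + 1) / (n + 1)) ^ 2 = 2 * a * Real.log (n + 1) / (n + 1) := Real.sq_sqrt (by positivity)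
    have hexp : Real.exp (-(((n : ℝ) + 1) * Real.sqrt (2 * a * Real.log (n + 1) / (n + 1)) ^ 2) / a) = 1 / ((n : ℝ) + 1) ^ 2 := by
      rw [hsq]
      have h2 : -(((n : ℝ) + 1) * (2 * a * Real.log (n + 1) / (n + 1))) / a = -Real.log (((n : ℝ) + 1) ^ 2) := by
        rw [Real.log_pow, Nat.cast_ofNat]
        field_simp
      rw [h2, Real.exp_neg, Real.exp_log (by positivity), one_div]
    calc P.real (s n) ≤ K * Real.exp (-(((n : ℝ) + 1) * Real.sqrt (2 * a * Real.log (n + 1) / (n + 1)) ^ 2) / a) := h1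
      _ = K / ((n : ℝ) + 1) ^ 2 := by rw [hexp]; ring
      _ ≤ (K + 1) / ((n : ℝ) + 1) ^ 2 := div_le_div_of_nonneg_right (by linarith) (by positivity)
  -- summability and Borel–Cantelli
  have hsum : Summable fun n : ℕ => (K + 1) / ((n : ℝ) + 1) ^ 2 := by
    have h1 : Summable fun n : ℕ => (((n + 1 : ℕ) : ℝ) ^ 2)⁻¹ := (summable_nat_add_iff 1).2 (Real.summable_nat_pow_inv.2 one_lt_two)
    have h2 := h1.mul_left (K + 1)
    refine h2.congr fun n => ?_
    push_cast
    ring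
  have htsum : (∑' n, P (s n)) ≠ ∞ := by
    have hle : ∀ n, P (s n) ≤ ENNReal.ofReal ((K + 1) / ((n : ℝ) + 1) ^ 2) := fun n => by
      rw [← ofReal_measureReal]
      exact ENNReal.ofReal_le_ofReal (hbound n)
    refine ne_top_of_le_ne_top ?_ (ENNReal.tsum_le_tsum hle)
    rw [← ENNReal.ofReal_tsum_of_nonneg (fun n => by positivity) hsum]
    exact ENNReal.ofReal_ne_top
  filter_upwards [ae_eventually_notMem htsum] with ω hω
  filter_upwards [hω] with n hn
  simpa only [hs, Set.mem_setOf_eq, not_le] using hn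

/-! ## §2. The volume-free almost-sure rates -/

variable {L : ℕ} [NeZero L]

/-- ★★★ **VOLUME-FREE ALMOST-SURE CONVERGENCE RATE for discrete samples of the cold-start sampler, `|β'| < 1/12`.**  For every `L`,
`|β'| < 1/12` (`λ := 1 − 12|β'|`, `r := e^{−λh}`), every deterministic start `z`, EVERY strong solution `U` from `z` on ANY filtered probability
space, EVERY measurable `G` with `|G| ≤ 1`, all `t₀, u` with `log B ≤ 2λt₀` and every `h > 0`: almost surely, for all sufficiently large `N`,

  `|N⁻¹ Σ_{k<N} G(U_{2+t₀+u+kh}) − ∫ G dμ_{β'}| < 4 · √( ((1+r)/(1−r)) · log N / N )`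

— the law-of-the-iterated-logarithm order up to the logarithm, with a constant INDEPENDENT of `L` (g34: `8·max(1, C/(1−e^{−ch}))`, Harris
`C, c` of the volume). [cite: LeonPerron2004, Theorem 1] -/
theorem ae_eventually_abs_average_sub_wilson_lt_uniform (L : ℕ) [NeZero L] (β' : ℝ) (hβ : |β'| < 1 / 12)
    (z : GaugeConfig 3 L (Matrix.specialUnitaryGroup (Fin 2) ℂ))
    {Ω : Type} [MeasurableSpace Ω] {P : Measure Ω} [IsProbabilityMeasure P]
    {W : ℝ≥0 → Ω → (Edge 3 L × NoiseIdx 2 → ℝ)} (hW : IsFlatBrownian W P)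
    {U : ℝ≥0 → Ω → GaugeConfig 3 L (Matrix.specialUnitaryGroup (Fin 2) ℂ)} (hU0 : ∀ ω, U 0 ω = z)
    (hU : (latticeLangevinDynamics (fundamentalLatticeRep 2) β').IsSolution (fundamentalRep (Fin 2)) hW.natFiltration P W U)
    {G : GaugeConfig 3 L (Matrix.specialUnitaryGroup (Fin 2) ℂ) → ℝ} (hG : Measurable G) (hG1 : ∀ x, |G x| ≤ 1) (t₀ u h : ℝ≥0)
    (ht₀ : Real.log (96 * |β'| * (Fintype.card (Edge 3 L) : ℝ) + 10 * |β'| * (Fintype.card (Plaquette 3 L) : ℝ) + Real.log 2 +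
      (Fintype.card (Edge 3 L) : ℝ) * Real.log (3 / 2)) ≤ 2 * (1 - 12 * |β'|) * t₀)
    (hh : 0 < (h : ℝ)) :
    ∀ᵐ ω ∂P, ∀ᶠ N : ℕ in atTop,
      |(N : ℝ)⁻¹ * (∑ k ∈ Finset.range N, G (U (2 + t₀ + u + (k : ℝ≥0) * h) ω)) - ∫ y, G y ∂(wilsonMeasure (d := 3) (L := L) (fundamentalRep (Fin 2)) β')| <
        4 * Real.sqrt (((1 + Real.exp (-((1 - 12 * |β'|) * h))) / (1 - Real.exp (-((1 - 12 * |β'|) * h)))) * Real.log N / N) := by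
  set m : ℝ := ∫ y, G y ∂(wilsonMeasure (d := 3) (L := L) (fundamentalRep (Fin 2)) β') with hm
  set r : ℝ := Real.exp (-((1 - 12 * |β'|) * h)) with hr
  have hlam : 0 < 1 - 12 * |β'| := by linarith
  have hr0 : 0 < r := Real.exp_pos _
  have hr1 : r < 1 := by rw [hr]; exact Real.exp_lt_one_iff.2 (by nlinarith)
  set κq : ℝ := (1 + r) / (1 - r) with hκq
  have hκq0 : 0 < κq := by rw [hκq]; exact div_pos (by linarith) (by linarith)
  set X : ℕ → Ω → ℝ := fun n ω => ((n : ℝ) + 1)⁻¹ * (∑ k ∈ Finset.range (n + 1), G (U (2 + t₀ + u + (k : ℝ≥0) * h) ω)) - m with hX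
  have ha : (0 : ℝ) < 8 * κq := by positivity
  have htail : ∀ (n : ℕ) (ε : ℝ), 0 < ε → P.real {ω | ε ≤ |X n ω|} ≤ (2 * Real.exp 2) * Real.exp (-((n + 1) * ε ^ 2) / (8 * κq)) := by
    intro n ε hε
    have h1 := coldStart_skeleton_hoeffding_deviation_uniform L β' hβ z hW hU0 hU hG hG1 t₀ u h ht₀ hh n hε
    rw [← hm, ← hr] at h1
    have e : -(((n : ℝ) + 1) * ((1 - r) / (1 + r)) * ε ^ 2 / 8) = -(((n : ℝ) + 1) * ε ^ 2) / (8 * κq) := by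
      have h1r : (1 : ℝ) - r ≠ 0 := by linarith
      have h1r' : (1 : ℝ) + r ≠ 0 := by linarith
      rw [hκq]; field_simp
    rw [e] at h1
    exact h1
  have hmain := ae_eventually_abs_lt_sqrt_log_div_of_le_mul_exp X ha (by positivity) htail
  filter_upwards [hmain] with ω hω
  refine eventually_atTop_of_eventually_succ ?_
  filter_upwards [hω] with n hn
  have hsq : Real.sqrt (2 * (8 * κq) * Real.log ((n : ℝ) + 1) / ((n : ℝ) + 1)) = 4 * Real.sqrt (κq * Real.log ((n + 1 : ℕ) : ℝ) / ((n + 1 : ℕ) : ℝ)) := by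
    have h16 : 2 * (8 * κq) * Real.log ((n : ℝ) + 1) / ((n : ℝ) + 1) = 4 ^ 2 * (κq * Real.log ((n + 1 : ℕ) : ℝ) / ((n + 1 : ℕ) : ℝ)) := by
      push_cast; ring
    rw [h16, Real.sqrt_mul (by positivity), Real.sqrt_sq (by positivity)]
  have hX' : X n ω = (((n + 1 : ℕ) : ℝ))⁻¹ * (∑ k ∈ Finset.range (n + 1), G (U (2 + t₀ + u + (k : ℝ≥0) * h) ω)) - m := by
    simp only [hX, Nat.cast_add, Nat.cast_one]
  rw [← hX', ← hsq]
  exact hn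

/-- ★★★ **VOLUME-FREE ALMOST-SURE RATE FOR EMPIRICAL FREQUENCIES of any event, `|β'| < 1/12`.**  In the same setting, for EVERY measurable set
`A` of configurations: almost surely, for all sufficiently large `N`,
`|N⁻¹ #{k<N : U_{2+t₀+u+kh} ∈ A} − μ_{β'}(A)| < 2 · √( ((1+r)/(1−r)) · log N / N )`. [cite: LeonPerron2004, Theorem 1] -/
theorem ae_eventually_abs_frequency_sub_wilson_lt_uniform (L : ℕ) [NeZero L] (β' : ℝ) (hβ : |β'| < 1 / 12)
    (z : GaugeConfig 3 L (Matrix.specialUnitaryGroup (Fin 2) ℂ))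
    {Ω : Type} [MeasurableSpace Ω] {P : Measure Ω} [IsProbabilityMeasure P]
    {W : ℝ≥0 → Ω → (Edge 3 L × NoiseIdx 2 → ℝ)} (hW : IsFlatBrownian W P)
    {U : ℝ≥0 → Ω → GaugeConfig 3 L (Matrix.specialUnitaryGroup (Fin 2) ℂ)} (hU0 : ∀ ω, U 0 ω = z)
    (hU : (latticeLangevinDynamics (fundamentalLatticeRep 2) β').IsSolution (fundamentalRep (Fin 2)) hW.natFiltration P W U)
    {A : Set (GaugeConfig 3 L (Matrix.specialUnitaryGroup (Fin 2) ℂ))} (hA : MeasurableSet A) (t₀ u h : ℝ≥0)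
    (ht₀ : Real.log (96 * |β'| * (Fintype.card (Edge 3 L) : ℝ) + 10 * |β'| * (Fintype.card (Plaquette 3 L) : ℝ) + Real.log 2 +
      (Fintype.card (Edge 3 L) : ℝ) * Real.log (3 / 2)) ≤ 2 * (1 - 12 * |β'|) * t₀)
    (hh : 0 < (h : ℝ)) :
    ∀ᵐ ω ∂P, ∀ᶠ N : ℕ in atTop,
      |(N : ℝ)⁻¹ * (∑ k ∈ Finset.range N, A.indicator (fun _ => (1 : ℝ)) (U (2 + t₀ + u + (k : ℝ≥0) * h) ω)) - ((wilsonMeasure (d := 3) (L := L) (fundamentalRep (Fin 2)) β')).real A| <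
        2 * Real.sqrt (((1 + Real.exp (-((1 - 12 * |β'|) * h))) / (1 - Real.exp (-((1 - 12 * |β'|) * h)))) * Real.log N / N) := by
  set p : ℝ := ((wilsonMeasure (d := 3) (L := L) (fundamentalRep (Fin 2)) β')).real A with hp
  set r : ℝ := Real.exp (-((1 - 12 * |β'|) * h)) with hr
  have hlam : 0 < 1 - 12 * |β'| := by linarith
  have hr0 : 0 < r := Real.exp_pos _
  have hr1 : r < 1 := by rw [hr]; exact Real.exp_lt_one_iff.2 (by nlinarith)
  set κq : ℝ := (1 + r) / (1 - r) with hκq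
  have hκq0 : 0 < κq := by rw [hκq]; exact div_pos (by linarith) (by linarith)
  set X : ℕ → Ω → ℝ := fun n ω =>
    ((n : ℝ) + 1)⁻¹ * (∑ k ∈ Finset.range (n + 1), A.indicator (fun _ => (1 : ℝ)) (U (2 + t₀ + u + (k : ℝ≥0) * h) ω)) - p with hX
  have ha : (0 : ℝ) < 2 * κq := by positivity
  have htail : ∀ (n : ℕ) (ε : ℝ), 0 < ε → P.real {ω | ε ≤ |X n ω|} ≤ (2 * Real.exp 2) * Real.exp (-((n + 1) * ε ^ 2) / (2 * κq)) := by
    intro n ε hε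
    have h1 := coldStart_skeleton_frequency_deviation_uniform L β' hβ z hW hU0 hU hA t₀ u h ht₀ hh n hε
    rw [← hp, ← hr] at h1
    have e : -(((n : ℝ) + 1) * ((1 - r) / (1 + r)) * ε ^ 2 / 2) = -(((n : ℝ) + 1) * ε ^ 2) / (2 * κq) := by
      have h1r : (1 : ℝ) - r ≠ 0 := by linarith
      have h1r' : (1 : ℝ) + r ≠ 0 := by linarith
      rw [hκq]; field_simp
    rw [e] at h1
    exact h1
  have hmain := ae_eventually_abs_lt_sqrt_log_div_of_le_mul_exp X ha (by positivity) htail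
  filter_upwards [hmain] with ω hω
  refine eventually_atTop_of_eventually_succ ?_
  filter_upwards [hω] with n hn
  have hsq : Real.sqrt (2 * (2 * κq) * Real.log ((n : ℝ) + 1) / ((n : ℝ) + 1)) = 2 * Real.sqrt (κq * Real.log ((n + 1 : ℕ) : ℝ) / ((n + 1 : ℕ) : ℝ)) := by
    have h4 : 2 * (2 * κq) * Real.log ((n : ℝ) + 1) / ((n : ℝ) + 1) = 2 ^ 2 * (κq * Real.log ((n + 1 : ℕ) : ℝ) / ((n + 1 : ℕ) : ℝ)) := by
      push_cast; ring
    rw [h4, Real.sqrt_mul (by positivity), Real.sqrt_sq (by positivity)]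
  have hX' : X n ω = (((n + 1 : ℕ) : ℝ))⁻¹ * (∑ k ∈ Finset.range (n + 1), A.indicator (fun _ => (1 : ℝ)) (U (2 + t₀ + u + (k : ℝ≥0) * h) ω)) - p := by
    simp only [hX, Nat.cast_add, Nat.cast_one]
  rw [← hX', ← hsq]
  exact hn

end Summit.QuantumFields.YangMills.Theorems.ColdStartUniversality

end
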